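import Literature.IUT.HodgeTheaters.InitialThetaDataNFBase
import HarnessLib

/-!
# [IUTchI] Corollary 1.2, the resp'd clause `Π_{C̲→}` derived from the `Π_{X̲→}` machinery — the
# orbicurve cusp binder `hLem45C` ELIMINATED — proof-only

Mochizuki, *Inter-universal Teichmüller theory I*, kurims manuscript (May 2020), §1, Corollary 1.2
"Characteristic Nature of Coverings", statement and PROOF p. 39 ([IUTchI] Cor 1.2 p.39)
[claim: Mochizuki2012, status: disputed]: "For simplicity, we consider the non-resp'd case; the
resp'd case is entirely similar [but slightly easier]."  Node `IUTchI:Cor1.2`; proof-only companion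
(no definitions, nothing restated) over abc-iut-L5-t1's FROZEN `PuncturedEllipticCoverings.lean` /
`…Cusps.lean` and the abc-iut-L5-d4 kernels `…XbarRecovery` (p429979), `…Cor12Assembly`,
`…Cor12Respd`, `…Cor12Thm26` (p437972), `…Cor12GeomTFG` (p441649), `…Cor12Lem45` (p442282),
`InitialThetaDataNFBase` (p443323).

WHAT THIS FILE DOES.  In the closers of record (`…_of_recoversCusps'`, p443323) the resp'd clause
`CharacteristicNatureOfCoverings.ofCarrow` (every bicontinuous `ψ : Π_{C̲→} ⥲ Π'_{C̲→}` extends to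
`Ψ : Π_C̲ ⥲ Π'_C̲` carrying the class of the decomposition groups of `ε̲`) consumed the binder
`hLem45C` — [AbsTopI] Lem. 4.5 for the ORBICURVE `C̲`, read on the cusps `x ≠ ε⁰` because the
decomposition group `D_{ε̲⁰} ⊆ Π_C̲` of the cusp `ε̲⁰` of `C̲` has no carrier in the frozen record —
the one binder of Cor. 1.2 with no by-name supplier.  Here the resp'd clause is DERIVED from the
`X̲`-level inputs that the non-resp'd clause already consumes:
* **`Θ(Π_{X̲→}) = Π'_{X̲→}`** for the core isomorphism `Θ : Π_C ⥲ Π'_C` extending `ψ` (which carries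
  `Π_{C̲→}`, `Δ_X`, `Δ_C` onto their counterparts): since `Π_{X̲→} = Π_{C̲→} ∩ Π_X` (the cartesian
  square of p. 38) and `Π_X` acts trivially on `Δ_X^{ab} ⊗ ℤ/lℤ` (the standing hypothesis (∗) of
  p. 37, the frozen field `star`), `Θ(Π_{X̲→})` centralises `Δ'_X` modulo
  `H' = Ker(Δ'_X ↠ Δ'_X^{ab} ⊗ ℤ/lℤ)` (transport of `H`, `map_H_eq`), hence lies in `Π'_X` GIVEN the
  classical-shaped law `hι'` at the primed datum — "`ι` acts on `Δ_E ⊗ (ℤ/lℤ)` via multiplication by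
  `−1`" (p. 37 last line – p. 38 l. 1), in the form used: an element of `Δ'_C̲ ∖ Δ'_X̲` does NOT
  centralise `Δ'_X^{ab} ⊗ ℤ/lℤ` (`−1 ≠ 1` on the nonzero `𝔽_l`-space `Δ_X^{ab} ⊗ 𝔽_l`, `l` odd);
  equality by counting the index `[Π_{C̲→} : Π_{X̲→}] = 2` (`map_piXarrow_eq_of_map_piCarrow`);
* hence `Θ(Π_X̲) = Π'_X̲` (`Π_X̲ = Π_{X̲→}·H`, p429979), the `X̲`-LEVEL cusp correspondence ([AbsTopI]
  Lem. 4.5 for the curve `X̲`: the pair-level `hLem45`, or abc-iut-L4's `RecoversCusps` BY NAME as in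
  p442282), `Θ(Π_C̲) = Π'_C̲` (`Π_C̲ = Π_{C̲→}·H`, `…Cor12Respd`), and the class of `ε̲` is transported
  by the non-resp'd kernel `image_cuspClassC_eq` (`…Cor12Assembly`) verbatim.
Main results: `ofCarrow_viaX` (resp'd clause from `hcoreC` + forward `X̲`-cusp correspondence +
`hι'`), `characteristicNatureOfCoverings_of_recoversCusps_viaX` (pair level, [AbsTopI] Lem. 4.5 (v) /
[AbsAnab] Lem. 1.1.4 (i) BY NAME), and at the `K`-level data of two initial Θ-data over number fields
`InitialThetaData.pe_characteristicNatureOfCoverings_viaX` — the closer of record p443323 with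
`hLem45C` REPLACED by `hι'` (needed at the primed datum ONLY: the reverse inclusion is an index count);
every other binder unchanged.  `H ⊴ Π_C` (`normal_H`) is proved on the way.

THE LAW `hι'` AND abc-iut-L5-t1's `ModLCuspLaws` (p446054).  `hι'` is stated on `Δ_X` modulo
`H = Ker(Δ_X ↠ Δ_X^{ab} ⊗ ℤ/lℤ)` (the closed subgroup of the frozen hypothesis (∗) `star`):
`∀ c ∈ Δ_C̲, c ∉ Δ_X̲ → ∃ v ∈ Δ_X, c v c⁻¹ v⁻¹ ∉ H`.  abc-iut-L5-t1's field `ModLCuspLaws.iota_neg` (L3)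
renders the same printed sentence on `Δ_X̲` modulo `I_ε′ · I_ε″ · Ker(Δ_X̲ ↠ Δ_ε)`; `hι'` follows from (L3)
together with "every cusp inertia group `I_x` lies in `H`" (the cusp of `X` is unramified in `X̲ → X`:
`I_x ⊆ [Δ_X, Δ_X]`, the (rel)-type law of p438104) and "`Δ_X̲ ⊄ H`" (`Δ_X^{ab} ⊗ 𝔽_l` has rank `2`), since
then `[c, v] ∈ H` for all `v ∈ Δ_X̲` would force `v² ∈ H`, `v^l ∈ H`, hence `Δ_X̲ ⊆ H` (`l` odd) — a bridge
left to a sequel so that this file imports nothing unbuilt; here `hι'` is a primitive NAMED binder.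
No side is taken on [IUTchIII] Cor. 3.12; binders are assumption labels; typed ≠ discharged.
-/

namespace Literature.IUT.HodgeTheaters

namespace PuncturedEllipticData

open scoped Pointwise
open Literature.AnabelianGeometry.AbsoluteAnabelian
open Literature.AnabelianGeometry.AbsoluteAnabelian.FundamentalExtension (CuspidalAlgorithm)
open Literature.AnabelianGeometry.AbsoluteAnabelian.AbsTopII (semiEllipticDoubleCoverSubgroups)

universe u

variable {D D' : PuncturedEllipticData.{u}}

/-! ### `H = Ker(Δ_X ↠ Δ_X^{ab} ⊗ ℤ/lℤ)` is normal in `Π_C` -/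

/-- `Δ_X = Π_X ∩ Δ_C` is normal in `Π_C` (`[Π_C : Π_X] = 2`, `Δ_C = Ker(Π_C ↠ G_k)`).
([IUTchI] §1 p.37) [claim: Mochizuki2012, status: disputed] -/
theorem normal_deltaX (D : PuncturedEllipticData.{u}) : (D.PiX ⊓ D.DeltaC).Normal := by
  haveI := D.piX_normal
  haveI : D.DeltaC.Normal := D.E.normal_geom
  infer_instance

/-- The subgroup generated by the `l`-th powers of `Δ_X` is normal in `Π_C` (the set of `l`-th powers of
the normal subgroup `Δ_X` is stable under conjugation). ([IUTchI] Cor 1.2 p.39)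
[claim: Mochizuki2012, status: disputed] -/
theorem normal_closure_pow_deltaX (D : PuncturedEllipticData.{u}) :
    (Subgroup.closure ((fun y : D.PiC => y ^ D.l) '' (D.PiX ⊓ D.DeltaC : Set D.PiC))).Normal := by
  haveI := D.normal_deltaX
  refine ⟨fun n hn g => ?_⟩
  refine Subgroup.closure_induction (p := fun x _ => g * x * g⁻¹ ∈
      Subgroup.closure ((fun y : D.PiC => y ^ D.l) '' (D.PiX ⊓ D.DeltaC : Set D.PiC))) ?_ ?_ ?_ ?_ hn
  · rintro _ ⟨y, hy, rfl⟩
    refine Subgroup.subset_closure ⟨g * y * g⁻¹, (D.normal_deltaX).conj_mem y hy g, ?_⟩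
    show (g * y * g⁻¹) ^ D.l = g * y ^ D.l * g⁻¹
    exact conj_pow
  · simpa only [mul_one, mul_inv_cancel] using Subgroup.one_mem _
  · intro x y _ _ hx hy
    have e : g * (x * y) * g⁻¹ = (g * x * g⁻¹) * (g * y * g⁻¹) := by group
    rw [e]
    exact Subgroup.mul_mem _ hx hy
  · intro x _ hx
    have e : g * x⁻¹ * g⁻¹ = (g * x * g⁻¹)⁻¹ := by group
    rw [e]
    exact Subgroup.inv_mem _ hx

/-- **`H = Ker(Δ_X ↠ Δ_X^{ab} ⊗ ℤ/lℤ)` — the closed subgroup of the standing hypothesis (∗) `star` — is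
normal in `Π_C`** (commutators and `l`-th powers of the normal subgroup `Δ_X`, closed up).
([IUTchI] Cor 1.2 p.39) [claim: Mochizuki2012, status: disputed] -/
theorem normal_H (D : PuncturedEllipticData.{u}) :
    (⁅D.PiX ⊓ D.DeltaC, D.PiX ⊓ D.DeltaC⁆ ⊔ Subgroup.closure
      ((fun y : D.PiC => y ^ D.l) '' (D.PiX ⊓ D.DeltaC : Set D.PiC))).topologicalClosure.Normal := by
  haveI := D.normal_deltaX
  haveI := D.normal_closure_pow_deltaX
  exact Subgroup.is_normal_topologicalClosure _

/-! ### `Θ(Π_{X̲→}) = Π'_{X̲→}` in the resp'd case -/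

/-- `[Π_{C̲→} : Π_{X̲→}] = 2` under the printed claims of p. 38 (`[Π_C̲ : Π_{X̲→}] = 2l`,
`[Π_C̲ : Π_{C̲→}] = l`). ([IUTchI] §1 p.38) [claim: Mochizuki2012, status: disputed] -/
theorem ArrowCoveringClaims.relIndex_piXarrow_piCarrow (h : D.ArrowCoveringClaims) :
    D.piXarrow.relIndex D.piCarrow = 2 := by
  have key := Subgroup.relIndex_mul_relIndex D.piXarrow D.piCarrow D.PiCbar D.piXarrow_le_piCarrow
    D.piCarrow_le_piCbar
  rw [h.piCarrow_relindex, h.piXarrow_relindex] at key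
  have hl : D.l ≠ 0 := by have := D.five_le; omega
  exact Nat.eq_of_mul_eq_mul_right (Nat.pos_of_ne_zero hl) key

/-- **`Θ(Π_{X̲→}) ⊆ Π'_{X̲→}` in the resp'd case.**  For `Θ : Π_C ⥲ Π'_C` bicontinuous with
`Θ(Π_{C̲→}) = Π'_{C̲→}`, `Θ(Δ_X) = Δ'_X` and `l = l'`: an element `g ∈ Π_{X̲→} ⊆ Π_X` centralises `Δ_X`
modulo `H` (the standing hypothesis (∗), frozen field `star`), so `Θ(g) ∈ Π'_{C̲→}` centralises `Δ'_X`
modulo `H' = Θ(H)`; writing `Θ(g) = p'·c'` with `p' ∈ Π'_{X̲→}` (same image in `G_{k'}`) and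
`c' ∈ Δ'_C̲`, the element `c'` still centralises `Δ'_X` modulo the NORMAL subgroup `H'`, so `c' ∈ Δ'_X̲`
by the law `hι'` ("`ι` acts on `Δ_E ⊗ ℤ/lℤ` via `−1`", p. 38 l. 1: no element of `Δ'_C̲ ∖ Δ'_X̲`
centralises `Δ'_X^{ab} ⊗ ℤ/lℤ`), whence `Θ(g) ∈ Π'_X ∩ Π'_{C̲→} = Π'_{X̲→}` (cartesian square, p. 38).
([IUTchI] Cor 1.2 p.39) [claim: Mochizuki2012, status: disputed] -/
theorem ArrowCoveringClaims.map_piXarrow_le_of_map_piCarrow (h' : D'.ArrowCoveringClaims)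
    (Θ : D.PiC ≃* D'.PiC) (hc : Continuous Θ) (hc' : Continuous Θ.symm)
    (hΘC : D.piCarrow.map Θ.toMonoidHom = D'.piCarrow)
    (hΘX : (D.PiX ⊓ D.DeltaC).map Θ.toMonoidHom = D'.PiX ⊓ D'.DeltaC) (hl : D.l = D'.l)
    (hι' : ∀ c ∈ D'.DeltaCbar, c ∉ D'.DeltaXbar → ∃ v ∈ D'.PiX ⊓ D'.DeltaC,
      c * v * c⁻¹ * v⁻¹ ∉ (⁅D'.PiX ⊓ D'.DeltaC, D'.PiX ⊓ D'.DeltaC⁆ ⊔ Subgroup.closure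
        ((fun y : D'.PiC => y ^ D'.l) '' (D'.PiX ⊓ D'.DeltaC : Set D'.PiC))).topologicalClosure) :
    D.piXarrow.map Θ.toMonoidHom ≤ D'.piXarrow := by
  haveI := D'.normal_H
  rintro _ ⟨g, hg, rfl⟩
  have hgC' : Θ.toMonoidHom g ∈ D'.piCarrow := by
    rw [← hΘC]
    exact ⟨g, D.piXarrow_le_piCarrow hg, rfl⟩
  -- `Θ g ∈ Π'_X`
  have hgX' : Θ.toMonoidHom g ∈ D'.PiX := by
    by_contra hnot
    obtain ⟨⟨p, hp⟩, hpg⟩ := D'.aug_piXarrow_surjective (D'.E.aug (Θ.toMonoidHom g))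
    have hpg' : D'.E.aug p = D'.E.aug (Θ.toMonoidHom g) := hpg
    -- `c := p⁻¹ Θ(g) ∈ Δ'_C̲ ∖ Δ'_X̲`
    have hcΔ : p⁻¹ * Θ.toMonoidHom g ∈ D'.DeltaC := by
      show p⁻¹ * Θ.toMonoidHom g ∈ D'.E.geom
      rw [FundamentalExtension.mem_geom, map_mul, map_inv, hpg', inv_mul_cancel]
    have hcCbar : p⁻¹ * Θ.toMonoidHom g ∈ D'.DeltaCbar := by
      show p⁻¹ * Θ.toMonoidHom g ∈ D'.PiCbar ⊓ D'.DeltaC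
      exact Subgroup.mem_inf.mpr ⟨D'.PiCbar.mul_mem (D'.PiCbar.inv_mem (D'.piXarrow_le_piCbar hp))
        (D'.piCarrow_le_piCbar hgC'), hcΔ⟩
    have hcX : p⁻¹ * Θ.toMonoidHom g ∉ D'.DeltaXbar := by
      intro hcX
      apply hnot
      have e : Θ.toMonoidHom g = p * (p⁻¹ * Θ.toMonoidHom g) := by group
      rw [e]
      exact D'.PiX.mul_mem ((inf_le_left : D'.PiXbar ≤ D'.PiX) (D'.piXarrow_le_piXbar hp))
        (Subgroup.mem_inf.mp (deltaXbar_le_deltaX hcX)).1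
    obtain ⟨v', hv', hιv⟩ := hι' _ hcCbar hcX
    -- `v' = Θ v`, `v ∈ Δ_X`
    have hv'mem : v' ∈ (D.PiX ⊓ D.DeltaC).map Θ.toMonoidHom := by rw [hΘX]; exact hv'
    obtain ⟨v, hv, rfl⟩ := hv'mem
    apply hιv
    -- `[Θ g, Θ v] = Θ [g, v] ∈ Θ(H) = H'`
    have h1 : Θ.toMonoidHom g * Θ.toMonoidHom v * (Θ.toMonoidHom g)⁻¹ * (Θ.toMonoidHom v)⁻¹ ∈
        (⁅D'.PiX ⊓ D'.DeltaC, D'.PiX ⊓ D'.DeltaC⁆ ⊔ Subgroup.closure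
          ((fun y : D'.PiC => y ^ D'.l) '' (D'.PiX ⊓ D'.DeltaC : Set D'.PiC))).topologicalClosure := by
      rw [← map_H_eq Θ hc hc' hΘX hl, ← map_inv, ← map_inv, ← map_mul, ← map_mul, ← map_mul]
      exact ⟨_, D.star g ((inf_le_left : D.PiXbar ≤ D.PiX) (D.piXarrow_le_piXbar hg)) v hv, rfl⟩
    -- `[p, Θ v] ∈ H'`
    have h2 : p * Θ.toMonoidHom v * p⁻¹ * (Θ.toMonoidHom v)⁻¹ ∈
        (⁅D'.PiX ⊓ D'.DeltaC, D'.PiX ⊓ D'.DeltaC⁆ ⊔ Subgroup.closure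
          ((fun y : D'.PiC => y ^ D'.l) '' (D'.PiX ⊓ D'.DeltaC : Set D'.PiC))).topologicalClosure :=
      D'.star p ((inf_le_left : D'.PiXbar ≤ D'.PiX) (D'.piXarrow_le_piXbar hp)) (Θ.toMonoidHom v) hv'
    -- `p [c, Θ v] p⁻¹ = [Θ g, Θ v] · [p, Θ v]⁻¹`
    have e : p⁻¹ * Θ.toMonoidHom g * Θ.toMonoidHom v * (p⁻¹ * Θ.toMonoidHom g)⁻¹ *
        (Θ.toMonoidHom v)⁻¹ = p⁻¹ * ((Θ.toMonoidHom g * Θ.toMonoidHom v * (Θ.toMonoidHom g)⁻¹ *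
          (Θ.toMonoidHom v)⁻¹) * (p * Θ.toMonoidHom v * p⁻¹ * (Θ.toMonoidHom v)⁻¹)⁻¹) * p⁻¹⁻¹ := by
      group
    rw [e]
    exact Subgroup.Normal.conj_mem inferInstance _ (Subgroup.mul_mem _ h1 (Subgroup.inv_mem _ h2)) p⁻¹
  -- `Π'_X ∩ Π'_{C̲→} = Π'_{X̲→}`
  rw [h'.cartesian]
  refine Subgroup.mem_inf.mpr ⟨?_, hgC'⟩
  show Θ.toMonoidHom g ∈ D'.PiX ⊓ D'.PiCbar
  exact Subgroup.mem_inf.mpr ⟨hgX', D'.piCarrow_le_piCbar hgC'⟩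

/-- **`Θ(Π_{X̲→}) = Π'_{X̲→}` in the resp'd case**: the inclusion of
`map_piXarrow_le_of_map_piCarrow` is an equality, both sides having index `2` in
`Θ(Π_{C̲→}) = Π'_{C̲→}`. ([IUTchI] Cor 1.2 p.39) [claim: Mochizuki2012, status: disputed] -/
theorem ArrowCoveringClaims.map_piXarrow_eq_of_map_piCarrow (h : D.ArrowCoveringClaims)
    (h' : D'.ArrowCoveringClaims) (Θ : D.PiC ≃* D'.PiC) (hc : Continuous Θ) (hc' : Continuous Θ.symm)
    (hΘC : D.piCarrow.map Θ.toMonoidHom = D'.piCarrow)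
    (hΘX : (D.PiX ⊓ D.DeltaC).map Θ.toMonoidHom = D'.PiX ⊓ D'.DeltaC) (hl : D.l = D'.l)
    (hι' : ∀ c ∈ D'.DeltaCbar, c ∉ D'.DeltaXbar → ∃ v ∈ D'.PiX ⊓ D'.DeltaC,
      c * v * c⁻¹ * v⁻¹ ∉ (⁅D'.PiX ⊓ D'.DeltaC, D'.PiX ⊓ D'.DeltaC⁆ ⊔ Subgroup.closure
        ((fun y : D'.PiC => y ^ D'.l) '' (D'.PiX ⊓ D'.DeltaC : Set D'.PiC))).topologicalClosure) :
    D.piXarrow.map Θ.toMonoidHom = D'.piXarrow := by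
  have hle := h'.map_piXarrow_le_of_map_piCarrow Θ hc hc' hΘC hΘX hl hι'
  refine le_antisymm hle (Subgroup.relIndex_eq_one.mp ?_)
  have h2 : (D.piXarrow.map Θ.toMonoidHom).relIndex D'.piCarrow = 2 := by
    rw [← hΘC, Subgroup.relIndex_map_map_of_injective (f := Θ.toMonoidHom) D.piXarrow D.piCarrow
      Θ.injective, h.relIndex_piXarrow_piCarrow]
  have key := Subgroup.relIndex_mul_relIndex (D.piXarrow.map Θ.toMonoidHom) D'.piXarrow D'.piCarrow
    hle D'.piXarrow_le_piCarrow
  rw [h'.relIndex_piXarrow_piCarrow, h2] at key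
  omega

/-! ### Corollary 1.2, resp'd clause, routed through `Π_{X̲→}` -/

/-- **Corollary 1.2, resp'd clause `Π_{C̲→}`, WITHOUT [AbsTopI] Lem. 4.5 for the orbicurve `C̲`.**  For
data `D, D'` satisfying the printed claims of p. 38, with cusp actions, the law `[Π_X : Π_X̲] = l` and the
printed ramification of `ε⁰` in `X̲→ → X̲`, GIVEN — as hypotheses, never asserted — `hcoreC` (every
bicontinuous `ψ : Π_{C̲→} ⥲ Π'_{C̲→}` extends to a bicontinuous `Θ : Π_C ⥲ Π'_C` with `Θ(Δ_X) = Δ'_X`,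
`Θ(Δ_C) = Δ'_C`: slimness + [AbsTopI] Thm. 2.6 (v)(vi) + [AbsTopII] Cor. 3.3 (i)(ii)), the FORWARD
`X̲`-level cusp correspondence `hcusp` ([AbsTopI] Lem. 4.5 for the CURVE `X̲`: a bicontinuous `Θ` with
`Θ(Π_X̲) = Π'_X̲`, `Θ(Δ_C) = Δ'_C` carries each `D_x` to a `Π'_X̲`-conjugate of some `D'_{x'}`) and the
law `hι'` (an element of `Δ'_C̲ ∖ Δ'_X̲` does not centralise `Δ'_X^{ab} ⊗ ℤ/lℤ`: "`ι` acts on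
`Δ_E ⊗ (ℤ/lℤ)` via multiplication by `−1`", p. 38 l. 1), every bicontinuous `ψ` extends to a continuous
`Ψ : Π_C̲ ⥲ Π'_C̲` carrying the class of the decomposition groups of `ε̲` onto its counterpart.
([IUTchI] Cor 1.2 p.39) [claim: Mochizuki2012, status: disputed] -/
theorem ofCarrow_viaX (h : D.ArrowCoveringClaims) (h' : D'.ArrowCoveringClaims)
    (C : D.CuspGalois) (C' : D'.CuspGalois) (hX : D.PiXbar.relIndex D.PiX = D.l)
    (hX' : D'.PiXbar.relIndex D'.PiX = D'.l) (h0 : ¬ D.inertia D.ε0 ≤ D.piXarrow)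
    (h0' : ¬ D'.inertia D'.ε0 ≤ D'.piXarrow)
    (hcoreC : ∀ ψ : D.piCarrow ≃* D'.piCarrow, Continuous ψ → Continuous ψ.symm →
      ∃ Θ : D.PiC ≃* D'.PiC, Continuous Θ ∧ Continuous Θ.symm ∧
        (∀ x : D.piCarrow, Θ (x : D.PiC) = (ψ x : D'.PiC)) ∧
        (D.PiX ⊓ D.DeltaC).map Θ.toMonoidHom = D'.PiX ⊓ D'.DeltaC ∧
        D.DeltaC.map Θ.toMonoidHom = D'.DeltaC)
    (hcusp : ∀ Θ : D.PiC ≃* D'.PiC, Continuous Θ → Continuous Θ.symm →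
      D.PiXbar.map Θ.toMonoidHom = D'.PiXbar → D.DeltaC.map Θ.toMonoidHom = D'.DeltaC →
        ∀ x : D.Cusp, ∃ x' : D'.Cusp, ∃ t' ∈ D'.PiXbar,
          (D.decomp x).map Θ.toMonoidHom = MulAut.conj t' • D'.decomp x')
    (hι' : ∀ c ∈ D'.DeltaCbar, c ∉ D'.DeltaXbar → ∃ v ∈ D'.PiX ⊓ D'.DeltaC,
      c * v * c⁻¹ * v⁻¹ ∉ (⁅D'.PiX ⊓ D'.DeltaC, D'.PiX ⊓ D'.DeltaC⁆ ⊔ Subgroup.closure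
        ((fun y : D'.PiC => y ^ D'.l) '' (D'.PiX ⊓ D'.DeltaC : Set D'.PiC))).topologicalClosure) :
    ∀ ψ : D.piCarrow ≃* D'.piCarrow, Continuous ψ → Continuous ψ.symm →
      ∃ Ψ : D.PiCbar ≃* D'.PiCbar, Continuous Ψ ∧
        (∀ (x : D.PiC) (hx : x ∈ D.piCarrow) (hx' : x ∈ D.PiCbar),
          (Ψ ⟨x, hx'⟩ : D'.PiC) = (ψ ⟨x, hx⟩ : D'.PiC)) ∧
        Subgroup.map Ψ.toMonoidHom '' D.cuspClassC = D'.cuspClassC := by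
  intro ψ hψ hψ'
  obtain ⟨Θ, hc, hc', hext, hΘX, hΘΔ⟩ := hcoreC ψ hψ hψ'
  have hΘC : D.piCarrow.map Θ.toMonoidHom = D'.piCarrow := map_eq_of_extends ψ Θ hext
  have hl : D.l = D'.l := h.l_eq_of_map_piCarrow_deltaC h' hX hX' Θ hΘC hΘΔ
  have hΘ : D.piXarrow.map Θ.toMonoidHom = D'.piXarrow :=
    h.map_piXarrow_eq_of_map_piCarrow h' Θ hc hc' hΘC hΘX hl hι'
  have hΘXbar : D.PiXbar.map Θ.toMonoidHom = D'.PiXbar :=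
    h.map_piXbar_eq_of_map_deltaX h' C C' hX hX' Θ hc hc' hΘ hΘX hΘΔ
  have hΘCbar : D.PiCbar.map Θ.toMonoidHom = D'.PiCbar :=
    h.map_piCbar_eq_of_map_piCarrow h' C C' hX hX' Θ hc hc' hΘC hΘX hΘΔ
  have hcuspΘ := hcusp Θ hc hc' hΘXbar hΘΔ
  obtain ⟨Ψ, hΨc, hΨ⟩ := exists_continuous_restrict_piCbar Θ hc hΘCbar
  exact ⟨Ψ, hΨc, fun x hx hx' => by rw [hΨ ⟨x, hx'⟩]; exact hext ⟨x, hx⟩,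
    image_map_subtype_transport Θ Ψ hΨ _ _
      (image_cuspClassC_eq h h' C C' Θ hΘ hΘΔ hΘXbar hΘCbar h0 h0' hcuspΘ)⟩

/-- **Corollary 1.2 (both clauses) from the printed anabelian inputs, WITHOUT `hLem45C`**: as
`characteristicNatureOfCoverings_of_anabelian'` (`…Cor12Respd`) — binders `ArrowCoveringClaims` ×2,
`CuspGalois` ×2, `[Π_X : Π_X̲] = l` ×2, ramification of `ε⁰` ×2, `hcore`, `hcoreC`, `hLem45`
([AbsTopI] Lem. 4.5 for the curve `X̲`, both directions) — with the orbicurve binder `hLem45C` replaced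
by the classical-shaped law `hι'` at the primed datum. ([IUTchI] Cor 1.2 p.39)
[claim: Mochizuki2012, status: disputed] -/
theorem characteristicNatureOfCoverings_of_anabelian_viaX (h : D.ArrowCoveringClaims)
    (h' : D'.ArrowCoveringClaims) (C : D.CuspGalois) (C' : D'.CuspGalois)
    (hX : D.PiXbar.relIndex D.PiX = D.l) (hX' : D'.PiXbar.relIndex D'.PiX = D'.l)
    (h0 : ¬ D.inertia D.ε0 ≤ D.piXarrow) (h0' : ¬ D'.inertia D'.ε0 ≤ D'.piXarrow)
    (hcore : ∀ φ : D.piXarrow ≃* D'.piXarrow, Continuous φ → Continuous φ.symm →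
      ∃ Θ : D.PiC ≃* D'.PiC, Continuous Θ ∧ Continuous Θ.symm ∧
        (∀ x : D.piXarrow, Θ (x : D.PiC) = (φ x : D'.PiC)) ∧
        (D.PiX ⊓ D.DeltaC).map Θ.toMonoidHom = D'.PiX ⊓ D'.DeltaC ∧
        D.DeltaC.map Θ.toMonoidHom = D'.DeltaC)
    (hcoreC : ∀ ψ : D.piCarrow ≃* D'.piCarrow, Continuous ψ → Continuous ψ.symm →
      ∃ Θ : D.PiC ≃* D'.PiC, Continuous Θ ∧ Continuous Θ.symm ∧
        (∀ x : D.piCarrow, Θ (x : D.PiC) = (ψ x : D'.PiC)) ∧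
        (D.PiX ⊓ D.DeltaC).map Θ.toMonoidHom = D'.PiX ⊓ D'.DeltaC ∧
        D.DeltaC.map Θ.toMonoidHom = D'.DeltaC)
    (hLem45 : ∀ Θ : D.PiC ≃* D'.PiC, Continuous Θ → Continuous Θ.symm →
      D.PiXbar.map Θ.toMonoidHom = D'.PiXbar →
        (∀ x : D.Cusp, ∃ x' : D'.Cusp, ∃ t' ∈ D'.PiXbar,
          (D.decomp x).map Θ.toMonoidHom = MulAut.conj t' • D'.decomp x') ∧
        (∀ x' : D'.Cusp, ∃ x : D.Cusp, ∃ t' ∈ D'.PiXbar,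
          (D.decomp x).map Θ.toMonoidHom = MulAut.conj t' • D'.decomp x'))
    (hι' : ∀ c ∈ D'.DeltaCbar, c ∉ D'.DeltaXbar → ∃ v ∈ D'.PiX ⊓ D'.DeltaC,
      c * v * c⁻¹ * v⁻¹ ∉ (⁅D'.PiX ⊓ D'.DeltaC, D'.PiX ⊓ D'.DeltaC⁆ ⊔ Subgroup.closure
        ((fun y : D'.PiC => y ^ D'.l) '' (D'.PiX ⊓ D'.DeltaC : Set D'.PiC))).topologicalClosure) :
    D.CharacteristicNatureOfCoverings D' :=
  characteristicNatureOfCoverings_of_core_extensions h h'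
    (ofXarrow_of_anabelian h h' C C' hX hX' h0 h0' hcore hLem45)
    (ofCarrow_viaX h h' C C' hX hX' h0 h0' hcoreC
      (fun Θ hc hc' hΘXbar _ => (hLem45 Θ hc hc' hΘXbar).1) hι')

/-- **Corollary 1.2 (Characteristic Nature of Coverings) with [AbsAnab] Lem. 1.1.4 (i) / [AbsTopI]
Thm. 2.6 (vi)'s conclusion, [AbsTopI] Lem. 4.5 (v) and the [AbsTopII] Cor. 3.3 (ii) transport supplied
BY NAME from layer L4, WITHOUT `hLem45C`.**  Binders (assumption labels, never asserted):
`ArrowCoveringClaims` ×2, `CuspGalois` ×2 (data), `[Π_X : Π_X̲] = l` ×2, ramification of `ε⁰` ×2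
(G-L5d4g6-1), `GeomIsMaxTFGNormalIn ⊤` ×2 (F-0005), `htf`, `huniq'`, `hext`, `hextC` (pure [AbsTopII]
Cor. 3.3 (i)), ONE cuspidal algorithm `A` with `RecoversCusps` at the two `X̲`-extensions (F-0206), and
the law `hι'` ("`ι` acts on `Δ_E ⊗ ℤ/lℤ` via `−1`", p. 38 l. 1) replacing the orbicurve binder `hLem45C`
of `characteristicNatureOfCoverings_of_geomIsMaxTFG_of_recoversCusps` (p442282).
([IUTchI] Cor 1.2 p.39) [claim: Mochizuki2012, status: disputed] -/
theorem characteristicNatureOfCoverings_of_recoversCusps_viaX (h : D.ArrowCoveringClaims)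
    (h' : D'.ArrowCoveringClaims) (C : D.CuspGalois) (C' : D'.CuspGalois)
    (hX : D.PiXbar.relIndex D.PiX = D.l) (hX' : D'.PiXbar.relIndex D'.PiX = D'.l)
    (h0 : ¬ D.inertia D.ε0 ≤ D.piXarrow) (h0' : ¬ D'.inertia D'.ε0 ≤ D'.piXarrow)
    (h114 : D.E.GeomIsMaxTFGNormalIn ⊤) (h114' : D'.E.GeomIsMaxTFGNormalIn ⊤)
    (htf : IsMulTorsionFree ↥(D.PiX ⊓ D.DeltaC))
    (huniq' : ∀ J ∈ semiEllipticDoubleCoverSubgroups D'.E, J ⊓ D'.DeltaC = D'.PiX ⊓ D'.DeltaC)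
    (hext : ∀ φ : D.piXarrow ≃* D'.piXarrow, Continuous φ → Continuous φ.symm →
      ∃ Θ : D.PiC ≃ₜ* D'.PiC, ∀ x : D.piXarrow, Θ (x : D.PiC) = (φ x : D'.PiC))
    (hextC : ∀ ψ : D.piCarrow ≃* D'.piCarrow, Continuous ψ → Continuous ψ.symm →
      ∃ Θ : D.PiC ≃ₜ* D'.PiC, ∀ x : D.piCarrow, Θ (x : D.PiC) = (ψ x : D'.PiC))
    (A : CuspidalAlgorithm.{u}) (hA : A.RecoversCusps D.extXbar C.cuspidalDataXbar)
    (hA' : A.RecoversCusps D'.extXbar C'.cuspidalDataXbar)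
    (hι' : ∀ c ∈ D'.DeltaCbar, c ∉ D'.DeltaXbar → ∃ v ∈ D'.PiX ⊓ D'.DeltaC,
      c * v * c⁻¹ * v⁻¹ ∉ (⁅D'.PiX ⊓ D'.DeltaC, D'.PiX ⊓ D'.DeltaC⁆ ⊔ Subgroup.closure
        ((fun y : D'.PiC => y ^ D'.l) '' (D'.PiX ⊓ D'.DeltaC : Set D'.PiC))).topologicalClosure) :
    D.CharacteristicNatureOfCoverings D' :=
  characteristicNatureOfCoverings_of_core_extensions h h'
    (ofXarrow_of_geomIsMaxTFG_of_recoversCusps h h' C C' hX hX' h0 h0' h114 h114' htf huniq' hext A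
      hA hA')
    (ofCarrow_viaX h h' C C' hX hX' h0 h0'
      (core_extension_of_geomIsMaxTFGNormalIn h114 h114' htf huniq' hextC)
      (fun Θ hc hc' hΘXbar hΘΔ =>
        (cusps_correspond_of_recoversCusps C C' A hA hA' Θ hc hc' hΘXbar hΘΔ).1) hι')

end PuncturedEllipticData

/-! ### At the `K`-level §1 datum of two initial Θ-data over number fields (universe `0`) -/

namespace InitialThetaData

open scoped Pointwise
open Literature.AnabelianGeometry.AbsoluteAnabelian
open Literature.AnabelianGeometry.AbsoluteAnabelian.FundamentalExtension (CuspidalAlgorithm)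
open Literature.AnabelianGeometry.AbsoluteAnabelian.AbsTopII (semiEllipticDoubleCoverSubgroups)

universe u u'

variable {F : Type u} {K : Type} {Fbar : Type} [Field F] [NumberField F] [Field K] [NumberField K]
  [Algebra F K] [Field Fbar] [Algebra F Fbar] [Algebra K Fbar]
  {E : WeierstrassCurve F} [E.IsElliptic] {l : ℕ} {Pb : BadPlacePredicates K}
  (D : InitialThetaData F K Fbar E l Pb)
  {F' : Type u'} {K' : Type} [Field F'] [NumberField F'] [Field K'] [NumberField K'] [Algebra F' K']
  {Fbar' : Type} [Field Fbar'] [Algebra F' Fbar'] [Algebra K' Fbar']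
  {E' : WeierstrassCurve F'} [E'.IsElliptic] {l' : ℕ} {Pb' : BadPlacePredicates K'}
  (D' : InitialThetaData F' K' Fbar' E' l' Pb')

/-- **[IUTchI] Cor. 1.2 between the `K`-level data of two initial Θ-data over number fields (`K`, `K'`,
`F̄`, `F̄'` in universe `0`) — the closer of record `pe_characteristicNatureOfCoverings_of_recoversCusps'`
(p443323) with the orbicurve binder `hLem45C` ELIMINATED.**  Binders (assumption labels, never
asserted): the printed claims of p. 38 ×2 (`ArrowCoveringClaims`), the cusp interfaces ×2 (`CuspGalois`,
data), the ramification of `ε⁰` ×2 (GAP-LEDGER G-L5d4g6-1), `GeomTFG` ×2 ([AbsTopI] Prop. 2.2, F-0240;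
number-field base data supplied by `peNFBase`), `htf`, `huniq'`, `hext`, `hextC` (pure [AbsTopII] Cor.
3.3 (i)), ONE cuspidal algorithm `A` with `RecoversCusps` at the two `X̲`-extensions ([AbsTopI] Lem.
4.5 (v), F-0206), and the classical-shaped law `hι'` at the primed datum: an element of `Δ'_C̲ ∖ Δ'_X̲`
does not centralise `Δ'_X^{ab} ⊗ ℤ/lℤ` ("`ι` acts on `Δ_E ⊗ (ℤ/lℤ)` via multiplication by `−1`",
p. 37 last line – p. 38 l. 1; an étale-`π₁` property of the geometric fundamental group of the
once-punctured elliptic curve, where `Δ_X^{ab} ⊗ 𝔽_l = E[l] ≠ 0` and `l` is odd).  The law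
`[Π_X : Π_X̲] = l` is DISCHARGED by Def. 3.1 (d). ([IUTchI] Cor 1.2 p.39)
[claim: Mochizuki2012, status: disputed] -/
theorem pe_characteristicNatureOfCoverings_viaX (h : D.geom.pe.ArrowCoveringClaims)
    (h' : D'.geom.pe.ArrowCoveringClaims) (C : D.geom.pe.CuspGalois) (C' : D'.geom.pe.CuspGalois)
    (h0 : ¬ D.geom.pe.inertia D.geom.pe.ε0 ≤ D.geom.pe.piXarrow)
    (h0' : ¬ D'.geom.pe.inertia D'.geom.pe.ε0 ≤ D'.geom.pe.piXarrow)
    (hΔ : D.geom.pe.E.GeomTFG) (hΔ' : D'.geom.pe.E.GeomTFG)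
    (htf : IsMulTorsionFree ↥(D.geom.pe.PiX ⊓ D.geom.pe.DeltaC))
    (huniq' : ∀ J ∈ semiEllipticDoubleCoverSubgroups D'.geom.pe.E,
      J ⊓ D'.geom.pe.DeltaC = D'.geom.pe.PiX ⊓ D'.geom.pe.DeltaC)
    (hext : ∀ φ : D.geom.pe.piXarrow ≃* D'.geom.pe.piXarrow, Continuous φ → Continuous φ.symm →
      ∃ Θ : D.geom.pe.PiC ≃ₜ* D'.geom.pe.PiC,
        ∀ x : D.geom.pe.piXarrow, Θ (x : D.geom.pe.PiC) = (φ x : D'.geom.pe.PiC))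
    (hextC : ∀ ψ : D.geom.pe.piCarrow ≃* D'.geom.pe.piCarrow, Continuous ψ → Continuous ψ.symm →
      ∃ Θ : D.geom.pe.PiC ≃ₜ* D'.geom.pe.PiC,
        ∀ x : D.geom.pe.piCarrow, Θ (x : D.geom.pe.PiC) = (ψ x : D'.geom.pe.PiC))
    (A : CuspidalAlgorithm.{0}) (hA : A.RecoversCusps D.geom.pe.extXbar C.cuspidalDataXbar)
    (hA' : A.RecoversCusps D'.geom.pe.extXbar C'.cuspidalDataXbar)
    (hι' : ∀ c ∈ D'.geom.pe.DeltaCbar, c ∉ D'.geom.pe.DeltaXbar →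
      ∃ v ∈ D'.geom.pe.PiX ⊓ D'.geom.pe.DeltaC,
        c * v * c⁻¹ * v⁻¹ ∉ (⁅D'.geom.pe.PiX ⊓ D'.geom.pe.DeltaC, D'.geom.pe.PiX ⊓ D'.geom.pe.DeltaC⁆ ⊔
          Subgroup.closure ((fun y : D'.geom.pe.PiC => y ^ D'.geom.pe.l) ''
            (D'.geom.pe.PiX ⊓ D'.geom.pe.DeltaC : Set D'.geom.pe.PiC))).topologicalClosure) :
    D.geom.pe.CharacteristicNatureOfCoverings D'.geom.pe :=
  PuncturedEllipticData.characteristicNatureOfCoverings_of_recoversCusps_viaX h h' C C'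
    D.pe_relIndex_piXbar_piX D'.pe_relIndex_piXbar_piX h0 h0'
    (PuncturedEllipticData.geomIsMaxTFGNormalIn_of_geomTFG D.peNFBase hΔ)
    (PuncturedEllipticData.geomIsMaxTFGNormalIn_of_geomTFG D'.peNFBase hΔ') htf huniq' hext hextC A
    hA hA' hι'

end InitialThetaData

end Literature.IUT.HodgeTheaters
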